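import Mathlib

/-!
# Route StarvedNecks — crux `NecksCertify`, line `bargmann-small-late-exterior`: rung M1

Stub `stub_bargmannSupContraction` (statement
`TonelliBargmann → CharacteristicCalculus → BargmannSupContraction` of the line skeleton, the three
`Prop`s unfolded verbatim): the 1+1 Bargmann sup-norm contraction.  All calculus (the d'Alembert
transport identities, hypothesis 2) and all measure theory of the weight `ν` (hypothesis 1) are
taken as hypotheses; what is proved here is the inequality bookkeeping:

* incoming bound: `w = (∂ₜ + ∂ᵣ)(ψ − χ)` vanishes on the slab `t = T`, and the incoming identity
  with foot on the slab gives `|w(t,r)| ≤ S · ∫_{(r,∞)} ν` for any bound `S` of `|ψ|` on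
  `Ω = {T ≤ t, R₀ ≤ r}` (the source is `D = −Vψ`, `|V| ≤ ν`);
* outgoing bound: `φ = ψ − χ` vanishes on the slab and on the cylinder `r = R₀`, and the outgoing
  identity with foot on slab-or-cylinder gives `|φ(t,r)| ≤ S · ∫_{R₀}^{r} (∫_{(ρ,∞)} ν) dρ ≤ S · η`
  by the double-integral (Tonelli) bound of hypothesis 1;
* hence `|ψ| ≤ C + η S` on `Ω`; the infimum `M` of all admissible nonnegative bounds satisfies
  `M ≤ C + η M`, i.e. `M ≤ C / (1 − η)`.

Mathlib only; no named facts.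
-/

noncomputable section

namespace Summit.FinalStateConjecture.FinalStateConjecture.Theorems.NecksCertifyBargmann.Contraction

open Filter Topology MeasureTheory Set Function
open scoped Topology

/-- **Incoming bound.**  If `w` satisfies the incoming transport identity with source `D`,
vanishes on the slab `t = T` beyond `R₀`, `|D| ≤ ν · |ψ|` on `Ω = {T ≤ t, R₀ ≤ r}` and `|ψ| ≤ S`
on `Ω`, then `|w(t,r)| ≤ S · ∫_{(r,∞)} ν` on `Ω` (for `ν ≥ 0` continuous on `[R₀, ∞)` and
integrable on `(R₀, ∞)`). -/
theorem incoming_bound {T R₀ S : ℝ} {ν : ℝ → ℝ} {ψ w D : ℝ → ℝ → ℝ}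
    (hν : ContinuousOn ν (Ici R₀)) (hν0 : ∀ s, R₀ ≤ s → 0 ≤ ν s)
    (hνint : IntegrableOn ν (Ioi R₀)) (hDcont : Continuous (uncurry D))
    (hin : ∀ t r a : ℝ, w t r = w (t - a) (r + a) + ∫ s in (0 : ℝ)..a, D (t - s) (r + s))
    (hslabw : ∀ r, R₀ ≤ r → w T r = 0)
    (hD : ∀ t r, T ≤ t → R₀ ≤ r → |D t r| ≤ ν r * |ψ t r|)
    (hS : ∀ t r, T ≤ t → R₀ ≤ r → |ψ t r| ≤ S) {t r : ℝ} (ht : T ≤ t) (hr : R₀ ≤ r) :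
    |w t r| ≤ S * ∫ s in Ioi r, ν s := by
  have hS0 : 0 ≤ S := (abs_nonneg _).trans (hS T R₀ le_rfl le_rfl)
  have htT : 0 ≤ t - T := sub_nonneg.mpr ht
  have hkey := hin t r (t - T)
  rw [sub_sub_cancel, hslabw (r + (t - T)) (by linarith), zero_add] at hkey
  have hDc : Continuous fun s ↦ D (t - s) (r + s) :=
    hDcont.comp (by fun_prop : Continuous fun s : ℝ ↦ (t - s, r + s))
  have hνc : ContinuousOn (fun s ↦ ν (r + s)) (uIcc 0 (t - T)) := by
    refine hν.comp (by fun_prop : Continuous fun s : ℝ ↦ r + s).continuousOn fun s hs ↦ ?_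
    rw [uIcc_of_le htT] at hs
    show R₀ ≤ r + s
    linarith [hs.1]
  rw [hkey]
  calc |∫ s in (0 : ℝ)..(t - T), D (t - s) (r + s)|
      ≤ ∫ s in (0 : ℝ)..(t - T), |D (t - s) (r + s)| :=
        intervalIntegral.abs_integral_le_integral_abs htT
    _ ≤ ∫ s in (0 : ℝ)..(t - T), S * ν (r + s) := by
        refine intervalIntegral.integral_mono_on htT (hDc.intervalIntegrable _ _).abs
          (hνc.intervalIntegrable.const_mul S) fun s hs ↦ ?_
        calc |D (t - s) (r + s)| ≤ ν (r + s) * |ψ (t - s) (r + s)| :=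
              hD _ _ (by linarith [hs.2]) (by linarith [hs.1])
          _ ≤ ν (r + s) * S :=
              mul_le_mul_of_nonneg_left (hS _ _ (by linarith [hs.2]) (by linarith [hs.1]))
                (hν0 _ (by linarith [hs.1]))
          _ = S * ν (r + s) := mul_comm _ _
    _ = S * ∫ s in r..(r + (t - T)), ν s := by
        rw [intervalIntegral.integral_const_mul, intervalIntegral.integral_comp_add_left, add_zero]
    _ ≤ S * ∫ s in Ioi r, ν s := by
        refine mul_le_mul_of_nonneg_left ?_ hS0
        rw [intervalIntegral.integral_of_le (by linarith)]
        exact setIntegral_mono_set (hνint.mono_set (Ioi_subset_Ioi hr))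
          (ae_restrict_of_forall_mem measurableSet_Ioi fun s (hs : r < s) ↦ hν0 s (by linarith))
          Ioc_subset_Ioi_self.eventuallyLE

/-- **Outgoing bound.**  If `φ` satisfies the outgoing transport identity with source `w`,
vanishes on the slab `t = T` beyond `R₀` and on the cylinder `r = R₀` after `T`, and
`|w(t,r)| ≤ S · I(r)` on `Ω` for a nonnegative antitone `I` on `[R₀, ∞)` with
`∫_{R₀}^{r} I ≤ B`, then `|φ| ≤ S · B` on `Ω` (foot of the outgoing ray on slab or cylinder,
whichever comes first). -/
theorem outgoing_bound {T R₀ S B : ℝ} {I : ℝ → ℝ} {φ w : ℝ → ℝ → ℝ}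
    (hwcont : Continuous (uncurry w))
    (hout : ∀ t r a : ℝ, φ t r = φ (t - a) (r - a) + ∫ s in (0 : ℝ)..a, w (t - s) (r - s))
    (hslabφ : ∀ r, R₀ ≤ r → φ T r = 0) (hcylφ : ∀ t, T ≤ t → φ t R₀ = 0)
    (hI0 : ∀ ρ, R₀ ≤ ρ → 0 ≤ I ρ) (hIanti : AntitoneOn I (Ici R₀))
    (hdouble : ∀ r, R₀ ≤ r → ∫ ρ in R₀..r, I ρ ≤ B)
    (hw : ∀ t r, T ≤ t → R₀ ≤ r → |w t r| ≤ S * I r) (hS0 : 0 ≤ S)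
    {t r : ℝ} (ht : T ≤ t) (hr : R₀ ≤ r) :
    |φ t r| ≤ S * B := by
  -- the foot of the outgoing ray through `(t, r)`: on the slab or on the cylinder
  obtain ⟨a, ha0, hat, har, hfoot⟩ :
      ∃ a : ℝ, 0 ≤ a ∧ a ≤ t - T ∧ a ≤ r - R₀ ∧ φ (t - a) (r - a) = 0 := by
    rcases le_total (t - T) (r - R₀) with h | h
    · refine ⟨t - T, sub_nonneg.mpr ht, le_rfl, h, ?_⟩
      rw [sub_sub_cancel]
      exact hslabφ _ (by linarith)
    · refine ⟨r - R₀, sub_nonneg.mpr hr, h, le_rfl, ?_⟩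
      rw [sub_sub_cancel]
      exact hcylφ _ (by linarith)
  have hkey := hout t r a
  rw [hfoot, zero_add] at hkey
  have hwc : Continuous fun s ↦ w (t - s) (r - s) :=
    hwcont.comp (by fun_prop : Continuous fun s : ℝ ↦ (t - s, r - s))
  have hmono : MonotoneOn (fun s ↦ I (r - s)) (uIcc 0 a) := by
    intro s₁ h₁ s₂ h₂ h12
    rw [uIcc_of_le ha0] at h₁ h₂
    show I (r - s₁) ≤ I (r - s₂)
    exact hIanti (show R₀ ≤ r - s₂ by linarith [h₂.2]) (show R₀ ≤ r - s₁ by linarith [h₁.2])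
      (by linarith)
  have hIint : IntervalIntegrable I volume R₀ r := by
    refine (hIanti.mono ?_).intervalIntegrable
    rw [uIcc_of_le hr]
    exact Icc_subset_Ici_self
  rw [hkey]
  calc |∫ s in (0 : ℝ)..a, w (t - s) (r - s)|
      ≤ ∫ s in (0 : ℝ)..a, |w (t - s) (r - s)| := intervalIntegral.abs_integral_le_integral_abs ha0
    _ ≤ ∫ s in (0 : ℝ)..a, S * I (r - s) := by
        refine intervalIntegral.integral_mono_on ha0 (hwc.intervalIntegrable _ _).abs
          (hmono.intervalIntegrable.const_mul S) fun s hs ↦ ?_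
        exact hw _ _ (by linarith [hs.2]) (by linarith [hs.2])
    _ = S * ∫ ρ in (r - a)..r, I ρ := by
        rw [intervalIntegral.integral_const_mul, intervalIntegral.integral_comp_sub_left, sub_zero]
    _ ≤ S * ∫ ρ in R₀..r, I ρ := by
        refine mul_le_mul_of_nonneg_left ?_ hS0
        exact intervalIntegral.integral_mono_interval (by linarith) (by linarith) le_rfl
          (ae_restrict_of_forall_mem measurableSet_Ioc fun ρ hρ ↦ hI0 ρ (le_of_lt hρ.1)) hIint
    _ ≤ S * B := mul_le_mul_of_nonneg_left (hdouble r hr) hS0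

/-- **The affine contraction.**  If `|ψ| ≤ P` on `Ω = {T ≤ t, R₀ ≤ r}` and every nonnegative
bound `S` of `|ψ|` on `Ω` improves to `C + η S` (`0 ≤ η < 1`, `0 ≤ C`), then `|ψ| ≤ C / (1 - η)`
on `Ω`: the infimum `M` of the admissible nonnegative bounds is admissible and `M ≤ C + η M`. -/
theorem sup_le_of_step {T R₀ η C P : ℝ} {ψ : ℝ → ℝ → ℝ} (hη0 : 0 ≤ η) (hη : η < 1)
    (hC0 : 0 ≤ C) (hP : ∀ t r, T ≤ t → R₀ ≤ r → |ψ t r| ≤ P)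
    (hstep : ∀ S, 0 ≤ S → (∀ t r, T ≤ t → R₀ ≤ r → |ψ t r| ≤ S) →
      ∀ t r, T ≤ t → R₀ ≤ r → |ψ t r| ≤ C + η * S) :
    ∀ t r, T ≤ t → R₀ ≤ r → |ψ t r| ≤ C / (1 - η) := by
  have hAne : {S : ℝ | 0 ≤ S ∧ ∀ t r, T ≤ t → R₀ ≤ r → |ψ t r| ≤ S}.Nonempty :=
    ⟨max P 0, le_max_right _ _, fun t r ht hr ↦ (hP t r ht hr).trans (le_max_left _ _)⟩
  have hAbdd : BddBelow {S : ℝ | 0 ≤ S ∧ ∀ t r, T ≤ t → R₀ ≤ r → |ψ t r| ≤ S} :=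
    ⟨0, fun S hS ↦ hS.1⟩
  set M := sInf {S : ℝ | 0 ≤ S ∧ ∀ t r, T ≤ t → R₀ ≤ r → |ψ t r| ≤ S}
  have hM0 : 0 ≤ M := le_csInf hAne fun S hS ↦ hS.1
  have hMQ : ∀ t r, T ≤ t → R₀ ≤ r → |ψ t r| ≤ M :=
    fun t r ht hr ↦ le_csInf hAne fun S hS ↦ hS.2 t r ht hr
  have hMle : M ≤ C + η * M :=
    csInf_le hAbdd ⟨add_nonneg hC0 (mul_nonneg hη0 hM0), hstep M hM0 hMQ⟩
  have hM : M ≤ C / (1 - η) := by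
    rw [le_div_iff₀ (sub_pos.mpr hη)]
    nlinarith [hMle]
  exact fun t r ht hr ↦ (hMQ t r ht hr).trans hM

/-- **M1 — Bargmann sup-norm contraction** (registered stub, conditional form
`TonelliBargmann → CharacteristicCalculus → BargmannSupContraction`).  If `|V(t,r)| ≤ ν(r)` with
Bargmann norm `∫_{(R₀,∞)} (s − R₀) ν(s) ds ≤ η < 1`, `ψ` solves `ψ_tt − ψ_rr + Vψ = 0` on
`Ω = {T ≤ t, R₀ ≤ r}`, `χ` solves the free equation on `Ω` with the same slab Cauchy data and
cylinder trace, `ψ` is a priori bounded on `Ω` and `|χ| ≤ C` on `Ω`, then `|ψ| ≤ C/(1 − η)` on `Ω`.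
Proof: `ν ≥ |V| ≥ 0` on `[R₀, ∞)` so hypothesis 1 applies (and `0 ≤ η`, `0 ≤ C`); hypothesis 2
supplies `φ = ψ − χ`, `w`, `D` with the two transport identities and the vanishing on slab and
cylinder; on `Ω` the two equations give `D = −Vψ`; `incoming_bound` and `outgoing_bound` (with
`I(ρ) = ∫_{(ρ,∞)} ν`, `B = ∫ (s − R₀)ν ≤ η`) give `|ψ| ≤ |φ| + |χ| ≤ η S + C` for every bound `S`
of `|ψ|` on `Ω`, and `sup_le_of_step` concludes. -/
theorem stub_bargmannSupContraction :
  (∀ (R₀ : ℝ) (ν : ℝ → ℝ), ContinuousOn ν (Set.Ici R₀) → (∀ s, R₀ ≤ s → 0 ≤ ν s) →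
      IntegrableOn (fun s ↦ (s - R₀) * ν s) (Set.Ioi R₀) →
      IntegrableOn ν (Set.Ioi R₀) ∧
      (∀ L ρ, 0 ≤ L → R₀ ≤ ρ → 0 ≤ ∫ s in Set.Ioi (ρ + L), ν s) ∧
      (∀ L, 0 ≤ L → AntitoneOn (fun ρ ↦ ∫ s in Set.Ioi (ρ + L), ν s) (Set.Ici R₀)) ∧
      (∀ L r, 0 ≤ L → R₀ ≤ r →
        ∫ ρ in R₀..r, (∫ s in Set.Ioi (ρ + L), ν s) ≤ ∫ s in Set.Ioi (R₀ + L), (s - R₀) * ν s) ∧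
      Tendsto (fun a ↦ ∫ s in Set.Ioi a, ν s) atTop (𝓝 0) ∧
      Tendsto (fun a ↦ ∫ s in Set.Ioi a, (s - R₀) * ν s) atTop (𝓝 0)) →
  (∀ (T R₀ : ℝ) (ψ χ : ℝ → ℝ → ℝ),
      ContDiff ℝ 2 (Function.uncurry ψ) → ContDiff ℝ 2 (Function.uncurry χ) →
      (∀ r, R₀ ≤ r → χ T r = ψ T r ∧ deriv (fun s ↦ χ s r) T = deriv (fun s ↦ ψ s r) T) →
      (∀ t, T ≤ t → χ t R₀ = ψ t R₀) →
      let φ : ℝ → ℝ → ℝ := fun t r ↦ ψ t r - χ t r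
      let w : ℝ → ℝ → ℝ := fun t r ↦
        deriv (fun s ↦ ψ s r - χ s r) t + deriv (fun s ↦ ψ t s - χ t s) r
      let z : ℝ → ℝ → ℝ := fun t r ↦
        deriv (fun s ↦ ψ s r - χ s r) t - deriv (fun s ↦ ψ t s - χ t s) r
      let D : ℝ → ℝ → ℝ := fun t r ↦
        (iteratedDeriv 2 (fun s ↦ ψ s r) t - iteratedDeriv 2 (ψ t) r) -
          (iteratedDeriv 2 (fun s ↦ χ s r) t - iteratedDeriv 2 (χ t) r)
      Continuous (Function.uncurry φ) ∧ Continuous (Function.uncurry w) ∧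
        Continuous (Function.uncurry z) ∧ Continuous (Function.uncurry D) ∧
      (∀ t r a : ℝ, w t r = w (t - a) (r + a) + ∫ s in (0 : ℝ)..a, D (t - s) (r + s)) ∧
      (∀ t r a : ℝ, φ t r = φ (t - a) (r - a) + ∫ s in (0 : ℝ)..a, w (t - s) (r - s)) ∧
      (∀ t r a : ℝ, z t r = z (t - a) (r - a) + ∫ s in (0 : ℝ)..a, D (t - s) (r - s)) ∧
      (∀ r, R₀ ≤ r → φ T r = 0 ∧ w T r = 0 ∧ z T r = 0) ∧
      (∀ t, T ≤ t → φ t R₀ = 0 ∧ z t R₀ = -w t R₀)) →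
  ∀ (T R₀ η C : ℝ) (ν : ℝ → ℝ) (V ψ χ : ℝ → ℝ → ℝ),
    0 ≤ R₀ → η < 1 →
    ContinuousOn ν (Set.Ici R₀) →
    IntegrableOn (fun s ↦ (s - R₀) * ν s) (Set.Ioi R₀) →
    (∫ s in Set.Ioi R₀, (s - R₀) * ν s) ≤ η →
    (∀ t r, T ≤ t → R₀ ≤ r → |V t r| ≤ ν r) →
    ContDiff ℝ 2 (Function.uncurry ψ) → ContDiff ℝ 2 (Function.uncurry χ) →
    (∀ t r, T ≤ t → R₀ ≤ r →
      iteratedDeriv 2 (fun s ↦ ψ s r) t - iteratedDeriv 2 (ψ t) r + V t r * ψ t r = 0) →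
    (∀ t r, T ≤ t → R₀ ≤ r → iteratedDeriv 2 (fun s ↦ χ s r) t - iteratedDeriv 2 (χ t) r = 0) →
    (∀ r, R₀ ≤ r → χ T r = ψ T r ∧ deriv (fun s ↦ χ s r) T = deriv (fun s ↦ ψ s r) T) →
    (∀ t, T ≤ t → χ t R₀ = ψ t R₀) →
    (∃ P : ℝ, ∀ t r, T ≤ t → R₀ ≤ r → |ψ t r| ≤ P) →
    (∀ t r, T ≤ t → R₀ ≤ r → |χ t r| ≤ C) →
    ∀ t r, T ≤ t → R₀ ≤ r → |ψ t r| ≤ C / (1 - η) := by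
  intro hR1 hR2 T R₀ η C ν V ψ χ _ hη hν hint hBarg hV hψ hχ heqψ heqχ hslab hcyl hP hC
  obtain ⟨P, hP⟩ := hP
  -- Step 0: signs (`ν ≥ |V| ≥ 0`, hence `0 ≤ η`; `Ω` is nonempty, hence `0 ≤ C`)
  have hν0 : ∀ s, R₀ ≤ s → 0 ≤ ν s := fun s hs ↦ (abs_nonneg _).trans (hV T s le_rfl hs)
  have hη0 : 0 ≤ η := by
    have h0 : 0 ≤ ∫ s in Ioi R₀, (s - R₀) * ν s :=
      setIntegral_nonneg measurableSet_Ioi fun s hs ↦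
        mul_nonneg (sub_nonneg.mpr (mem_Ioi.mp hs).le) (hν0 s (mem_Ioi.mp hs).le)
    exact h0.trans hBarg
  have hC0 : 0 ≤ C := (abs_nonneg _).trans (hC T R₀ le_rfl le_rfl)
  -- Step 1: the measure theory of `ν` (hypothesis 1, specialised to `L = 0`)
  obtain ⟨hνint, hInonneg, hIanti, hdouble, -, -⟩ := hR1 R₀ ν hν hν0 hint
  have hI0 : ∀ ρ, R₀ ≤ ρ → 0 ≤ ∫ s in Ioi ρ, ν s := fun ρ hρ ↦ by
    simpa only [add_zero] using hInonneg 0 ρ le_rfl hρ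
  have hIanti0 : AntitoneOn (fun ρ ↦ ∫ s in Ioi ρ, ν s) (Ici R₀) := by
    simpa only [add_zero] using hIanti 0 le_rfl
  have hdouble0 : ∀ r, R₀ ≤ r →
      ∫ ρ in R₀..r, (∫ s in Ioi ρ, ν s) ≤ ∫ s in Ioi R₀, (s - R₀) * ν s := fun r hr ↦ by
    simpa only [add_zero] using hdouble 0 r le_rfl hr
  -- Step 1': the characteristic calculus (hypothesis 2) and `D = -Vψ` on `Ω`
  obtain ⟨-, hwcont, -, hDcont, hin, hout, -, hslab0, hcyl0⟩ := hR2 T R₀ ψ χ hψ hχ hslab hcyl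
  have hD : ∀ t r, T ≤ t → R₀ ≤ r →
      |(iteratedDeriv 2 (fun s ↦ ψ s r) t - iteratedDeriv 2 (ψ t) r) -
          (iteratedDeriv 2 (fun s ↦ χ s r) t - iteratedDeriv 2 (χ t) r)| ≤ ν r * |ψ t r| := by
    intro t r ht hr
    have h : (iteratedDeriv 2 (fun s ↦ ψ s r) t - iteratedDeriv 2 (ψ t) r) -
        (iteratedDeriv 2 (fun s ↦ χ s r) t - iteratedDeriv 2 (χ t) r) = -(V t r * ψ t r) := by
      linarith [heqψ t r ht hr, heqχ t r ht hr]
    rw [h, abs_neg, abs_mul]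
    exact mul_le_mul_of_nonneg_right (hV t r ht hr) (abs_nonneg _)
  -- Steps 2–5: improve any bound `S` of `|ψ|` on `Ω` to `C + η S`, then contract
  refine sup_le_of_step hη0 hη hC0 hP fun S hS0 hS t r ht hr ↦ ?_
  have hw := fun t' r' (ht' : T ≤ t') (hr' : R₀ ≤ r') ↦
    incoming_bound hν hν0 hνint hDcont hin (fun ρ hρ ↦ (hslab0 ρ hρ).2.1) hD hS ht' hr'
  have hφ := outgoing_bound hwcont hout (fun ρ hρ ↦ (hslab0 ρ hρ).1)
    (fun t' ht' ↦ (hcyl0 t' ht').1) hI0 hIanti0 hdouble0 hw hS0 ht hr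
  have hφ' : |ψ t r - χ t r| ≤ S * η := hφ.trans (mul_le_mul_of_nonneg_left hBarg hS0)
  calc |ψ t r| = |ψ t r - χ t r + χ t r| := by rw [sub_add_cancel]
    _ ≤ |ψ t r - χ t r| + |χ t r| := abs_add_le _ _
    _ ≤ S * η + C := add_le_add hφ' (hC t r ht hr)
    _ = C + η * S := by ring

end Summit.FinalStateConjecture.FinalStateConjecture.Theorems.NecksCertifyBargmann.Contraction

end
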